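import Summits.Ventures.GridStability.Lyapunov.WSCC9LossySplitLinesCast
import Summits.Ventures.GridStability.Bench.WSCC9LossySplitSlabRoa
import HarnessLib

/-!
# GridStability/Bench/WSCC9LossySplitLinesRoa — «SPLITU-8°»: the kernel-checked Lur'e–Postnikov SLAB certificate
# of sos-2 at γ = 2·arctan(7/100) ≈ 8.008° for the post-fault WSCC 3-machine classical model WITH TRANSFER
# CONDUCTANCES in Pai's UNORDERED-LINES split presentation, its sector facts, and the certified region (file 3/3)

Cell `gridfusion` (LADDER-GRIDFUSION G2.c lossy tier); seat gridfusion-lit-6 (g9).  The template is lyap-2's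
`Bench/WSCC9LossySplitSlabRoa.lean` (ORDERED split, γ = 2·arctan(1/50)); its closed-form sector lemmas
`sector_sin_of_values` / `sector_cos_of_values`, the channel-angle bound `abs_angle_sub_lt` and the slab reading
`mem_slab_iff` are REUSED by name (the two split presentations have the same `C`, `δ*` and slab by `rfl`).

OBJECT: `WSCC9.splitLurieLinesSystem` (lit-6 g9, `Models/WSCC9SplitLurieLines.lean`) = lit-6's UNORDERED-LINES
split Lur'e system (`LossyMultimachineLurieSplitLines`, Pai (3.43)–(3.45): ONE sine + ONE cosine channel per LINE
`p < q` feeding BOTH machines) of the instance of record «WSCC9-postB-SPdamp-h12»: the Anderson–Fouad / Sauer–Pai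
WSCC 3-machine 9-bus classical model, post-fault network B Kron-reduced WITH transfer conductances (h12 couplings),
damping `D_i/M_i = 1/10, 1/5, 3/10`, A1 rational equilibrium `θ* = angleOf`; states `(ω₀, ω₁, ω₂ | σ₁, σ₂)`,
18 channels (6 active lines, 12 null).  DATA: `Lyapunov/WSCC9LossySplitLinesData.lean` (sos-2 Λ
`6ece98adcda3423c`: `u = 7/100`, `γ_lo = 69829/500000`, `ε = 11501/2²⁴`, `η = 10⁻⁶`; kernel `LDLᵀ` facts) and
`Lyapunov/WSCC9LossySplitLinesCast.lean` (`cert : SlabCertificate WSCC9.splitLurieLinesSystem`, `rankOne`).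
WHAT IS PROVED HERE: (1) the per-channel rational sector tests at the circle point `(cos γ, sin γ) =
(9951, 1400)/10049` of `γ = 2·arctan(7/100)` (`null_slopes` / `sine_tests` / `cosine_tests`, kernel); (2) `hsec` — the sector hypothesis of
lit-6's theorem for all 18 channels on the slab `γ`; (3) `hlev` — the rank-one level `c_rk =
1103995277/156250000000000 < γ²/s_k`; (4) **THE SENTENCE** `lossy_splitLines_slab_roa` = `WSCC9.lossy_splitLines_roa`
∘ lit-6 `InternalNode.lurieState_tendsto_zero_of_slabCertificate_lines`: **for MODEL M′ = `WSCC9.postB_SPdamp.toModel`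
(transfer conductances KEPT): every solution on `ℝ` whose initial Lur'e state lies in the open slab — all six
machine-angle-difference deviations `|(δ_p − δ_q) − (θ*_p − θ*_q)| < 2·arctan(7/100)` (≈ 8.008°) — with
`V ≤ lev` for any `lev ≤ c_rk` (`V = xᵀPx + 2Σ λ_k∫F_k`, the slab Lyapunov function of `cert`) keeps both for all
`t ≥ 0`, and its Lur'e state tends to `0`: every `ω_i → 0` and every `δ_p − δ_0 → θ*_p − θ*_0`**
(`lossy_splitLines_slab_sync`; well-posed form `lossy_splitLines_slab_wellPosed`).
WHY IT MATTERS (next-wave datum): the directed polar presentation's slab classes are kernel-CAPPED below this window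
(`WSCC9LossySlabDual33`: class of record EMPTY from 2·arctan(33/500) ≈ 7.552°; `WSCC9LossySlabLPDual`: positivity
class EMPTY from 2·arctan(67/1000) ≈ 7.666°); lane V's certificate of record is 7.495° — the PRESENTATION is a
window lever (same model, same theorem kind); `γ₀_dual33_lt_γ` / `γ₀_lpDual_lt_γ` record the order in the kernel.
THREE COLUMNS. CERTIFIED (kernel, this file + Data + Cast): the statements below for MODEL M′, CLASS = the well
`{slab 2·arctan(7/100), V ≤ c_rk}` (inner estimate; VALIDATED region datum, sos-2 07:11Z: inner state ball ≈ 0.15°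
— window-rich, region-poor; unordered split infeasible from 8.58° in floats — not part of the claim). MODELLED
«WSCC9-postB-SPdamp-h12» (MV-2 + MV-P + MV-SPD + MV-ω + MV-h12; classical network-reduced model, constant-impedance
loads, transfer conductances KEPT). VALIDATED: the SDP solve (CVXOPT). Nothing here says the WSCC system or any
grid is stable.
-/

noncomputable section

open Set Filter Topology Real Matrix
open Literature.MathematicalPhysics.PowerSystems
open Literature.MathematicalPhysics.PowerSystems.LyapunovFunctionFamily
open Literature.Computation.Certificates
open Summit.Ventures.GridStability.Models
open Summit.Ventures.GridStability.Lyapunov.WSCC9LossySplitLines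
open Summit.Ventures.GridStability.Lyapunov.WSCC9LossySplitSlab (eκ)
open Summit.Ventures.GridStability.Bench.WSCC9LossySplitSlab (sector_sin_of_values sector_cos_of_values
  abs_angle_sub_lt)

namespace Summit.Ventures.GridStability.Bench.WSCC9LossySplitLines

/-! ### The slab half-width `γ = 2·arctan(7/100)` and its circle point -/

/-- The declared half-width is `2·arctan u`, `u = uQ = 7/100`. -/
theorem uQ_cast : ((uQ : ℚ) : ℝ) = 7 / 100 := by norm_num [uQ]

/-- `cos γ = 9951/10049` and `sin γ = 1400/10049` for `γ = 2·arctan(7/100)` (cast form of the rationals). -/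
theorem cos_sin_gamma : Real.cos (2 * Real.arctan (7 / 100 : ℝ)) = ((9951 / 10049 : ℚ) : ℝ) ∧
    Real.sin (2 * Real.arctan (7 / 100 : ℝ)) = ((1400 / 10049 : ℚ) : ℝ) := by
  rw [Lyapunov.StructurePreserving.cos_two_mul_arctan, Lyapunov.StructurePreserving.sin_two_mul_arctan]
  constructor <;> push_cast <;> norm_num

/-- `0 ≤ γ < π/2`. -/
theorem gamma_range : 0 ≤ 2 * Real.arctan (7 / 100 : ℝ) ∧ 2 * Real.arctan (7 / 100 : ℝ) < π / 2 :=
  ⟨Lyapunov.StructurePreserving.two_mul_arctan_nonneg (by norm_num),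
    Lyapunov.StructurePreserving.two_mul_arctan_lt_pi_div_two (by norm_num)⟩

/-- `γ_lo < γ` (`γ_lo²(1 + u²) ≤ 4u²`, model-2's `lt_two_arctan_of_sq_le`). -/
theorem gloQ_lt_gamma : ((gloQ : ℚ) : ℝ) < 2 * Real.arctan (7 / 100 : ℝ) := by
  rw [← uQ_cast]
  exact StructurePreserving.lt_two_arctan_of_sq_le (by exact_mod_cast circle_u.2.2.1)
    (by exact_mod_cast glo_test.1) (by exact_mod_cast glo_test.2)

/-! ### The per-channel rational sector tests at the 8.008° window (kernel `decide`s, split by channel family) -/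

/-- **Null-channel slopes** (the 12 channels with `p ≥ q` carry `a = −1`, `b = 1`; here the diagonal ones, which
`hsec` treats apart; kernel). -/
theorem null_slopes : ∀ p : Fin 3,
    aQ (eκ (Sum.inl (p, p))) = -1 ∧ bQ (eκ (Sum.inl (p, p))) = 1 ∧
      aQ (eκ (Sum.inr (p, p))) = -1 ∧ bQ (eκ (Sum.inr (p, p))) = 1 := by
  decide +kernel

/-- **Sine-family tests at `(cos γ, sin γ) = (9951, 1400)/10049`** for every ordered pair `p ≠ q` (the lines
`p < q` with sos-2's slopes, the null pairs `p > q` with `a = −1`, `b = 1`): `sin γ ≤ |sd|` (narrow window),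
`a ≤ cd·cos γ − |sd|·sin γ = cos(|δ*| + γ)`, `cos(|δ*| − γ) = cd·cos γ + |sd|·sin γ ≤ b` (kernel). -/
theorem sine_tests : ∀ p q : Fin 3, p ≠ q →
    (1400 / 10049 : ℚ) ≤ |WSCC9.postB_SPdamp.sd p q| ∧
      aQ (eκ (Sum.inl (p, q))) ≤ WSCC9.postB_SPdamp.cd p q * (9951 / 10049) - |WSCC9.postB_SPdamp.sd p q| * (1400 / 10049) ∧
      WSCC9.postB_SPdamp.cd p q * (9951 / 10049) + |WSCC9.postB_SPdamp.sd p q| * (1400 / 10049) ≤ bQ (eκ (Sum.inl (p, q))) := by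
  decide +kernel

/-- **Cosine-family tests at `(cos γ, sin γ) = (9951, 1400)/10049`** for every ordered pair `p ≠ q`: `sin γ ≤ cd`
(`|θ*| + γ ≤ π/2`), `a ≤ −(sd·cos γ + cd·sin γ) = −sin(θ* + γ)`, `−sin(θ* − γ) = −(sd·cos γ − cd·sin γ) ≤ b` (kernel). -/
theorem cosine_tests : ∀ p q : Fin 3, p ≠ q →
    (1400 / 10049 : ℚ) ≤ WSCC9.postB_SPdamp.cd p q ∧
      aQ (eκ (Sum.inr (p, q))) ≤ -(WSCC9.postB_SPdamp.sd p q * (9951 / 10049) + WSCC9.postB_SPdamp.cd p q * (1400 / 10049)) ∧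
      -(WSCC9.postB_SPdamp.sd p q * (9951 / 10049) - WSCC9.postB_SPdamp.cd p q * (1400 / 10049)) ≤ bQ (eκ (Sum.inr (p, q))) := by
  decide +kernel

/-! ### The sector hypothesis of lit-6's theorem, all 18 channels -/

/-- **`hsec`**: on the slab `|ξ − δ*_k| ≤ γ = 2·arctan(7/100)` every channel's cosine lies in `[a_k, b_k]`
(`δ*_k = θ*_p − θ*_q` on the sine channel `inl (p,q)`, `θ*_p − θ*_q + π/2` on the cosine channel `inr (p,q)`). -/
theorem hsec : ∀ k ξ, |ξ - InternalNode.splitShift WSCC9.postB_SPdamp.angleOf k| ≤ 2 * Real.arctan (7 / 100 : ℝ) →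
    cert.a k ≤ Real.cos ξ ∧ Real.cos ξ ≤ cert.b k := by
  rintro (⟨p, q⟩ | ⟨p, q⟩) ξ hξ
  · rw [(cert_a_b _).1, (cert_a_b _).2]
    simp only [InternalNode.splitShift, Sum.elim_inl] at hξ
    by_cases hpq : p = q
    · subst hpq
      obtain ⟨h1, h2, -, -⟩ := null_slopes p
      rw [h1, h2]; push_cast
      exact ⟨Real.neg_one_le_cos ξ, Real.cos_le_one ξ⟩
    · obtain ⟨t1, t2, t3⟩ := sine_tests p q hpq
      refine sector_sin_of_values (abs_angle_sub_lt p q) gamma_range.1 gamma_range.2 (WSCC9.sin_angleOf_sub p q)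
        (WSCC9.cos_angleOf_sub p q) cos_sin_gamma.1 cos_sin_gamma.2 ?_ ?_ ?_ ξ hξ
      · rw [← Rat.cast_abs]; exact_mod_cast t1
      · rw [← Rat.cast_abs]; exact_mod_cast t2
      · rw [← Rat.cast_abs]; exact_mod_cast t3
  · rw [(cert_a_b _).1, (cert_a_b _).2]
    simp only [InternalNode.splitShift, Sum.elim_inr] at hξ
    by_cases hpq : p = q
    · subst hpq
      obtain ⟨-, -, h1, h2⟩ := null_slopes p
      rw [h1, h2]; push_cast
      exact ⟨Real.neg_one_le_cos ξ, Real.cos_le_one ξ⟩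
    · obtain ⟨t1, t2, t3⟩ := cosine_tests p q hpq
      refine sector_cos_of_values (abs_angle_sub_lt p q) gamma_range.2.le (WSCC9.sin_angleOf_sub p q)
        (WSCC9.cos_angleOf_sub p q) cos_sin_gamma.1 cos_sin_gamma.2 ?_ ?_ ?_ ξ hξ
      · exact_mod_cast t1
      · exact_mod_cast t2
      · exact_mod_cast t3

/-! ### The certified level -/

/-- **`hlev`**: the rank-one level passes on every channel — `lev ≤ c_rk ⇒ lev < γ²/s_k`
(`c_rk·s_k ≤ γ_lo² < γ²`). -/
theorem hlev {lev : ℝ} (hle : lev ≤ ((cRkQ : ℚ) : ℝ)) (k : (Fin 3 × Fin 3) ⊕ (Fin 3 × Fin 3)) :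
    lev < (2 * Real.arctan (7 / 100 : ℝ)) ^ 2 / ((sK k : ℚ) : ℝ) := by
  have hs : (0 : ℝ) < ((sK k : ℚ) : ℝ) := sK_pos k
  have ht : ((cRkQ : ℚ) : ℝ) * ((sK k : ℚ) : ℝ) ≤ ((gloQ : ℚ) : ℝ) ^ 2 := by
    unfold sK; exact_mod_cast (cRk_test (eκ k)).2
  have hg : ((gloQ : ℚ) : ℝ) ^ 2 < (2 * Real.arctan (7 / 100 : ℝ)) ^ 2 :=
    pow_lt_pow_left₀ gloQ_lt_gamma (by exact_mod_cast glo_test.1) two_ne_zero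
  rw [lt_div_iff₀ hs]
  nlinarith

/-! ### The slab in machine-angle terms (same slab as the ordered split, by `rfl`) -/

/-- **The slab in machine-angle terms**: the Lur'e state of `z = (δ, ω)` lies in the open slab `γ` of the
unordered-lines system iff every machine-angle-difference deviation satisfies `|(δ_p − δ_q) − (θ*_p − θ*_q)| < γ`. -/
theorem mem_slab_iff (z : ClassicalSwing.State 3) (γ : ℝ) :
    WSCC9.postB_SPdamp.lurieState WSCC9.postB_SPdamp.angleOf z ∈ WSCC9.splitLurieLinesSystem.slab (fun _ => γ) ↔
      ∀ p q : Fin 3, |(z.1 p - z.1 q) - (WSCC9.postB_SPdamp.angleOf p - WSCC9.postB_SPdamp.angleOf q)| < γ := by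
  rw [WSCC9.splitLurieLinesSystem_slab]
  exact WSCC9LossySplitSlab.mem_slab_iff z γ

/-! ### The sentence -/

/-- **«SPLITU-8°» — the certified region of the post-fault WSCC 3-machine classical model WITH TRANSFER
CONDUCTANCES at the window 2·arctan(7/100), UNORDERED-LINES split presentation.** For MODEL M′ =
`WSCC9.postB_SPdamp.toModel` (post-fault-B Kron reduction, h12 couplings, `D_i/M_i = 1/10, 1/5, 3/10`, equilibrium
`θ* = angleOf`): every solution `c` on `ℝ` whose initial Lur'e state lies in the open slab `γ = 2·arctan(7/100)`
(every `|(δ_p − δ_q) − (θ*_p − θ*_q)| < γ`, `mem_slab_iff`) and has `V ≤ lev` for a level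
`lev ≤ c_rk = 1103995277/156250000000000` (`V = xᵀPx + 2Σ_k λ_k∫₀^{y_k}F_k`, the slab Lyapunov function of sos-2's
certificate `cert`) keeps BOTH for all `t ≥ 0`, and its Lur'e state tends to `0`.
CERTIFIED for MODEL M′, CLASS = the well `{slab γ, V ≤ lev}` (inner estimate, a priori over all solutions; the
ε-level `c_ε = ε·γ_lo²/2 ≤ c_rk` is admissible); MODELLED «WSCC9-postB-SPdamp-h12» (MV-2 + MV-P + MV-SPD + MV-ω
+ MV-h12, transfer conductances KEPT); VALIDATED: the SDP solve and the region-size datum (inner ball ≈ 0.15°).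
Nothing here says the WSCC system is stable.
[cite: Pai1981, §2.16 Theorem [18] eqs. (2.63)–(2.64), §3.6.3 eqs. (3.43)–(3.45); VuTuritsyn2017, §4.3 Theorem 1] -/
theorem lossy_splitLines_slab_roa {lev : ℝ} (hle : lev ≤ ((cRkQ : ℚ) : ℝ))
    {c : ℝ → ClassicalSwing.State 3} (hc : WSCC9.postB_SPdamp.toModel.IsSolutionOn c univ)
    (h0 : WSCC9.postB_SPdamp.lurieState WSCC9.postB_SPdamp.angleOf (c 0)
      ∈ WSCC9.splitLurieLinesSystem.slab (fun _ => 2 * Real.arctan (7 / 100 : ℝ)))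
    (h0c : cert.V (WSCC9.postB_SPdamp.lurieState WSCC9.postB_SPdamp.angleOf (c 0)) ≤ lev) :
    (∀ t, 0 ≤ t →
        WSCC9.postB_SPdamp.lurieState WSCC9.postB_SPdamp.angleOf (c t)
            ∈ WSCC9.splitLurieLinesSystem.slab (fun _ => 2 * Real.arctan (7 / 100 : ℝ)) ∧
          cert.V (WSCC9.postB_SPdamp.lurieState WSCC9.postB_SPdamp.angleOf (c t)) ≤ lev) ∧
      Tendsto (fun t => WSCC9.postB_SPdamp.lurieState WSCC9.postB_SPdamp.angleOf (c t)) atTop (𝓝 0) :=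
  WSCC9.lossy_splitLines_roa cert hsec (fun k => sK_pos k) rankOne (hlev hle) hc h0 h0c

/-- **The same, read in machine coordinates (synchronisation).** Under the hypotheses of
`lossy_splitLines_slab_roa`: for all `t ≥ 0` every machine-angle-difference deviation stays `< 2·arctan(7/100)`;
every speed deviation `ω_i(t) → 0`; every relative angle `δ_{a+1}(t) − δ_0(t) → θ*_{a+1} − θ*_0`.
MODELLED «WSCC9-postB-SPdamp-h12»; nothing here says the WSCC system is stable.
[cite: Pai1981, §3.6.3 eqs. (3.43)–(3.45); VuTuritsyn2017, §4.3 Theorem 1] -/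
theorem lossy_splitLines_slab_sync {lev : ℝ} (hle : lev ≤ ((cRkQ : ℚ) : ℝ))
    {c : ℝ → ClassicalSwing.State 3} (hc : WSCC9.postB_SPdamp.toModel.IsSolutionOn c univ)
    (h0 : ∀ p q : Fin 3, |((c 0).1 p - (c 0).1 q) - (WSCC9.postB_SPdamp.angleOf p - WSCC9.postB_SPdamp.angleOf q)|
      < 2 * Real.arctan (7 / 100 : ℝ))
    (h0c : cert.V (WSCC9.postB_SPdamp.lurieState WSCC9.postB_SPdamp.angleOf (c 0)) ≤ lev) :
    (∀ t, 0 ≤ t → ∀ p q : Fin 3,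
        |((c t).1 p - (c t).1 q) - (WSCC9.postB_SPdamp.angleOf p - WSCC9.postB_SPdamp.angleOf q)|
          < 2 * Real.arctan (7 / 100 : ℝ)) ∧
      (∀ i : Fin 3, Tendsto (fun t => (c t).2 i) atTop (𝓝 0)) ∧
      ∀ a : Fin 2, Tendsto (fun t => (c t).1 a.succ - (c t).1 0) atTop
        (𝓝 (WSCC9.postB_SPdamp.angleOf a.succ - WSCC9.postB_SPdamp.angleOf 0)) := by
  obtain ⟨hkeep, hlim⟩ := lossy_splitLines_slab_roa hle hc ((mem_slab_iff _ _).2 h0) h0c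
  have hcoord := tendsto_pi_nhds.1 hlim
  refine ⟨fun t ht => (mem_slab_iff _ _).1 (hkeep t ht).1, fun i => ?_, fun a => ?_⟩
  · have h := hcoord (Sum.inl i)
    simp only [RecastData.lurieState_eq, Sum.elim_inl, Pi.zero_apply] at h
    exact h
  · have h := hcoord (Sum.inr a)
    simp only [RecastData.lurieState_eq, Sum.elim_inr, Pi.zero_apply] at h
    have h2 := h.add_const (WSCC9.postB_SPdamp.angleOf a.succ - WSCC9.postB_SPdamp.angleOf 0)
    simp only [zero_add, sub_add_cancel] at h2
    exact h2

/-- **«SPLITU-8°», well-posed form.** For MODEL M′ = `WSCC9.postB_SPdamp.toModel` (post-fault-B Kron reduction,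
transfer conductances KEPT, `D_i/M_i = 1/10, 1/5, 3/10`) and every machine state `z = (δ, ω)` with all six
`|(δ_p − δ_q) − (θ*_p − θ*_q)| < 2·arctan(7/100)` and `V(z) ≤ lev ≤ c_rk = 1103995277/156250000000000` (`V` = the
slab Lyapunov function of sos-2's certificate `cert` read on the Lur'e state): (i) a solution `c` of M′ on all of
`ℝ` with `c 0 = z` EXISTS; (ii) every solution from `z` on `univ` is that one; (iii) along it every
machine-angle-difference deviation stays `< 2·arctan(7/100)` and `V ≤ lev` for all `t ≥ 0`, every speed deviation
`ω_i(t) → 0` and every relative angle `δ_{a+1}(t) − δ_0(t) → θ*_{a+1} − θ*_0`.  CERTIFIED for MODEL M′, CLASS =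
the well `{slab 2·arctan(7/100), V ≤ lev}`; MODELLED «WSCC9-postB-SPdamp-h12»; VALIDATED: the SDP solve and the
region-size datum. Nothing here says the WSCC system is stable.
[cite: Pai1981, §2.16 Theorem [18], §3.6.3 eqs. (3.43)–(3.45); VuTuritsyn2017, §4.3 Theorem 1; Hartman2002, Ch. III Thm. 5.1] -/
theorem lossy_splitLines_slab_wellPosed {lev : ℝ} (hle : lev ≤ ((cRkQ : ℚ) : ℝ)) (z : ClassicalSwing.State 3)
    (hz : ∀ p q : Fin 3, |(z.1 p - z.1 q) - (WSCC9.postB_SPdamp.angleOf p - WSCC9.postB_SPdamp.angleOf q)|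
      < 2 * Real.arctan (7 / 100 : ℝ))
    (hzc : cert.V (WSCC9.postB_SPdamp.lurieState WSCC9.postB_SPdamp.angleOf z) ≤ lev) :
    (∃ c : ℝ → ClassicalSwing.State 3, c 0 = z ∧ WSCC9.postB_SPdamp.toModel.IsSolutionOn c univ) ∧
      ∀ c : ℝ → ClassicalSwing.State 3, c 0 = z → WSCC9.postB_SPdamp.toModel.IsSolutionOn c univ →
        (∀ c' : ℝ → ClassicalSwing.State 3, c' 0 = z → WSCC9.postB_SPdamp.toModel.IsSolutionOn c' univ →
            c' = c) ∧
        (∀ t, 0 ≤ t →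
          (∀ p q : Fin 3,
              |((c t).1 p - (c t).1 q) - (WSCC9.postB_SPdamp.angleOf p - WSCC9.postB_SPdamp.angleOf q)|
                < 2 * Real.arctan (7 / 100 : ℝ)) ∧
            cert.V (WSCC9.postB_SPdamp.lurieState WSCC9.postB_SPdamp.angleOf (c t)) ≤ lev) ∧
        (∀ i : Fin 3, Tendsto (fun t => (c t).2 i) atTop (𝓝 0)) ∧
        ∀ a : Fin 2, Tendsto (fun t => (c t).1 a.succ - (c t).1 0) atTop
          (𝓝 (WSCC9.postB_SPdamp.angleOf a.succ - WSCC9.postB_SPdamp.angleOf 0)) := by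
  refine ⟨WSCC9.postB_SPdamp_exists_solution z, fun c hc0 hc => ?_⟩
  have hkeep := lossy_splitLines_slab_roa hle hc ((mem_slab_iff _ _).2 (hc0.symm ▸ hz)) (hc0.symm ▸ hzc)
  have hsync := lossy_splitLines_slab_sync hle hc (hc0.symm ▸ hz) (hc0.symm ▸ hzc)
  refine ⟨fun c' hc0' hc' => WSCC9.postB_SPdamp_solution_unique hc' hc (hc0'.trans hc0.symm), ?_,
    hsync.2.1, hsync.2.2⟩
  intro t ht
  exact ⟨hsync.1 t ht, (hkeep.1 t ht).2⟩

/-! ### Where this window sits against the directed-polar class ceilings (kernel order facts) -/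

/-- **Above the class-of-record ceiling**: «#74′»'s window `2·arctan(33/500)` (from which NO `SlabCertificate` on the
directed polar object `WSCC9.lurieSystem` exists, `WSCC9LossySlabDual33.slabClass_empty`) is strictly below this
file's certified window `2·arctan(7/100)`. -/
theorem γ₀_dual33_lt_γ : 2 * Real.arctan (33 / 500 : ℝ) < 2 * Real.arctan (7 / 100 : ℝ) := by
  have := Real.arctan_strictMono (show (33 / 500 : ℝ) < 7 / 100 by norm_num)
  linarith

/-- **Above the positivity-class ceiling**: «#74-LP»'s window `2·arctan(67/1000)` (from which NO `LPSlabCertificate`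
on `WSCC9.lurieSystem` exists, `WSCC9LossySlabLPDual.lpSlabClass_empty`) is strictly below `2·arctan(7/100)`. -/
theorem γ₀_lpDual_lt_γ : 2 * Real.arctan (67 / 1000 : ℝ) < 2 * Real.arctan (7 / 100 : ℝ) := by
  have := Real.arctan_strictMono (show (67 / 1000 : ℝ) < 7 / 100 by norm_num)
  linarith

end Summit.Ventures.GridStability.Bench.WSCC9LossySplitLines

end
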